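import Summits.AnomalousDissipation.AnomalousDissipation.Theorems.KolmogorovFloor.Negative.TwoModes
import Literature.Analysis.FunctionSpaces.TorusFourierSeries

/-!
# Support for the sub-Taylor floor refutation (negative side of `KolmogorovFloor`, stmt-14030)

cdisprove seat `refuter-cdisprove-stmt-AnomalousDissipation-14030-0` (2026-08-16). Three ingredients of
`Negative/BelowTaylor.lean` (every band-limited floor class `N ≤ Cν^{-β}`, `β < 1/2`, is dead):
* `floor_beat_at_rest_inj` — the floor at the two-mode state dressed on rest, with the injection at rest
  `(f, Φ₁'(0))` kept exact (the `ℓ²` bound of `floor_beat_at_rest` loses `√#ball`);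
* `integral_inner_le_tsum_mul_max` — the WIENER bound `(f, G) ≤ A(f) · max_k ‖Ĝ(k)‖`, `A(f) = Σ_k ‖f̂(k)‖ < ∞`
  for smooth `f` (`Torus.summable_norm_mFourierCoeff_of_isSmooth`): the largest resolved coefficient of the
  multiplier at rest is `≥ ε₀/A(f)`, uniformly in the resolution;
* `rpow` bookkeeping (`nu_mul_sq_le`, `rpow_le_of_le_root`) and the real endgame `endgame_below`.
-/

noncomputable section

open MeasureTheory UnitAddTorus Matrix
open scoped InnerProductSpace ENNReal ComplexConjugate

namespace Summit.AnomalousDissipation.AnomalousDissipation.Theorems.KolmogorovFloor.Negative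

open Literature.Analysis.FunctionSpaces Literature.Analysis.FluidPDE
open Summit.AnomalousDissipation.AnomalousDissipation.Theorems.TaylorCertificatePair.Negative

/-! ### The floor at the dressed state, injection kept -/

/-- **FLOOR at the beat state dressed on rest, injection kept**: as `floor_beat_at_rest` but with the injection
at rest `(f, Φ'(0))` itself on the right instead of its `ℓ²` bound: if the two unresolved transversal modes `p`, `p + q` (with `(u_w, f) ≥ 0`, which the sign of
the polarisations can always arrange) satisfy the floor inequality, then
`gain + ε₀ ≤ ‖f‖₂ 𝔊 + (1 + 2Θ) ν 4π² L² (2α)²`, where `-gain` bounds the beat, `𝔊` is the truncated `ℓ²`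
coefficient norm of the multiplier at rest `G = Φ'(0)` and `L` bounds the wave frequencies. -/
theorem floor_beat_at_rest_inj {f : (UnitAddTorus (Fin 3)) → (EuclideanSpace ℝ (Fin 3))} {ν : ℝ} (hν : 0 < ν)
    (Φ : Torus.CylindricalTest (Fin 3)) {N : ℕ} (hΦ : ∀ i, Torus.fourierTruncate N (Φ.g i) = Φ.g i)
    {θ Θ ε₀ : ℝ} (hθ : -Θ ≤ θ) (hθ' : θ ≤ 0)
    {p q : Fin 3 → ℤ} {zA zB : (EuclideanSpace ℂ (Fin 3))} {α : ℝ}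
    (uw : (Torus.energySpace (Fin 3))) (huw : (((uw : (Torus.energySpace (Fin 3))) : (Lp (EuclideanSpace ℝ (Fin 3)) 2 (volume : Measure (UnitAddTorus (Fin 3))))) : (UnitAddTorus (Fin 3)) → (EuclideanSpace ℝ (Fin 3))) =ᵐ[volume] (∑ mm, Torus.realTrigPoly {![p, p + q] mm} (fun _ => ![zA, zB] mm)))
    (hA : ((fun j => ((p) j : ℂ)) ⬝ᵥ (WithLp.ofLp (zA))) = 0) (hB : ((fun j => (((p + q)) j : ℂ)) ⬝ᵥ (WithLp.ofLp (zB))) = 0)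
    (hBq : ((fun j => ((q) j : ℂ)) ⬝ᵥ (WithLp.ofLp (zB))) = 0)
    (hzA : ‖zA‖ ≤ α) (hzB : ‖zB‖ ≤ α)
    (hNp : (N : ℝ) ^ 2 < Torus.freqNormSq p) (hNpq : (N : ℝ) ^ 2 < Torus.freqNormSq (p + q))
    (hN5 : (N : ℝ) ^ 2 < Torus.freqNormSq (p + (p + q)))
    {L : ℕ} (hL : ∀ m, Torus.freqNormSq ((![p, p + q] : Fin 2 → (Fin 3 → ℤ)) m) ≤ (L : ℝ) ^ 2)
    {gain : ℝ}
    (hbeat : Real.pi * (conj (((fun j => ((q) j : ℂ)) ⬝ᵥ (WithLp.ofLp (zA)))) * ⟪(mFourierCoeff (EuclideanSpace.complexify ∘ (Φ.grad 0)) q), zB⟫_ℂ).im ≤ -gain)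
    (hsign : 0 ≤ ∫ x, ⟪(∑ mm, Torus.realTrigPoly {![p, p + q] mm} (fun _ => ![zA, zB] mm)) x, f x⟫_ℝ)
    (hfloor : ε₀ ≤ ν * (Torus.eGradNormSq (((uw : (Torus.energySpace (Fin 3))) : (Lp (EuclideanSpace ℝ (Fin 3)) 2 (volume : Measure (UnitAddTorus (Fin 3))))) : (UnitAddTorus (Fin 3)) → (EuclideanSpace ℝ (Fin 3)))).toReal +
        Torus.nsGeneratorPairing ν f uw (Φ.grad uw) +
      2 * θ * (Torus.pairing ((uw : (Torus.energySpace (Fin 3))) : (Lp (EuclideanSpace ℝ (Fin 3)) 2 (volume : Measure (UnitAddTorus (Fin 3))))) f -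
        ν * (Torus.eGradNormSq (((uw : (Torus.energySpace (Fin 3))) : (Lp (EuclideanSpace ℝ (Fin 3)) 2 (volume : Measure (UnitAddTorus (Fin 3))))) : (UnitAddTorus (Fin 3)) → (EuclideanSpace ℝ (Fin 3)))).toReal)) :
    gain + ε₀ ≤ (∫ x, ⟪f x, Φ.grad 0 x⟫_ℝ) + (1 + 2 * Θ) * (ν * (4 * Real.pi ^ 2 * (L : ℝ) ^ 2 * (α + α) ^ 2)) := by
  set G := Φ.grad 0 with hGdef
  have hG : Torus.IsSmooth G := isSmooth_grad Φ 0
  have hband : ∀ κ, (N : ℝ) ^ 2 < Torus.freqNormSq κ →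
      mFourierCoeff (EuclideanSpace.complexify ∘ G) κ = 0 := fc_grad_eq_zero Φ hΦ 0
  have hband' : ∀ κ, (N : ℝ) ^ 2 < Torus.freqNormSq κ → (mFourierCoeff (EuclideanSpace.complexify ∘ G) κ) = 0 := hband
  -- the dressed state has the differential of rest
  have hgrad : Φ.grad uw = G := by
    rw [hGdef]
    exact grad_eq_of_coords_eq Φ (coords_two_eq Φ hΦ hNp hNpq huw)
  rw [hgrad, nsGeneratorPairing_of_ae huw, pairing_of_ae huw, eGradNormSq_congr_ae' huw] at hfloor
  have hα : 0 ≤ α := (norm_nonneg zA).trans hzA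
  have hsum : ∑ m, ‖(![zA, zB] : Fin 2 → (EuclideanSpace ℂ (Fin 3))) m‖ ≤ α + α := by
    simp only [Fin.sum_univ_two, Matrix.cons_val_zero, Matrix.cons_val_one]
    linarith
  have hsum0 : 0 ≤ ∑ m, ‖(![zA, zB] : Fin 2 → (EuclideanSpace ℂ (Fin 3))) m‖ := Finset.sum_nonneg fun m _ => norm_nonneg _
  -- (2) Laplacian term: the waves are invisible to `ΔG`
  have h2 : ∫ x, ⟪(∑ mm, Torus.realTrigPoly {![p, p + q] mm} (fun _ => ![zA, zB] mm)) x, Torus.laplacian G x⟫_ℝ = 0 :=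
    laplacian_two hG zA zB (hband' p hNp) (hband' (p + q) hNpq)
  -- (3) the beat
  have h3 : ∫ x, ⟪Torus.fderiv G x ((∑ mm, Torus.realTrigPoly {![p, p + q] mm} (fun _ => ![zA, zB] mm)) x),
      (∑ mm, Torus.realTrigPoly {![p, p + q] mm} (fun _ => ![zA, zB] mm)) x⟫_ℝ ≤ -gain := by
    rw [inertial_two hG p q zA zB hA hB hBq (hband' _ hN5) (hband' _ (by rwa [add_comm]))]
    exact hbeat
  -- (4) the viscous price of the waves
  have hint : ∫ x, ‖(∑ mm, Torus.realTrigPoly {![p, p + q] mm} (fun _ => ![zA, zB] mm)) x‖ ^ 2 ≤ (α + α) ^ 2 :=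
    integral_norm_sq_modes_le.trans (pow_le_pow_left₀ hsum0 hsum 2)
  have h5 : 0 ≤ ν * (Torus.eGradNormSq ((∑ mm, Torus.realTrigPoly {![p, p + q] mm} (fun _ => ![zA, zB] mm)))).toReal := by
    positivity
  have h6 : ν * (Torus.eGradNormSq ((∑ mm, Torus.realTrigPoly {![p, p + q] mm} (fun _ => ![zA, zB] mm)))).toReal ≤
      ν * (4 * Real.pi ^ 2 * (L : ℝ) ^ 2 * (α + α) ^ 2) := by
    refine mul_le_mul_of_nonneg_left ?_ hν.le
    exact (toReal_eGradNormSq_modes_le hL).trans (mul_le_mul_of_nonneg_left hint (by positivity))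
  -- (5) the energy channel: injection signed away, dissipation priced by `2Θ`
  have hΘ : 0 ≤ Θ := by linarith
  have h7 : 2 * θ * ((∫ x, ⟪(∑ mm, Torus.realTrigPoly {![p, p + q] mm} (fun _ => ![zA, zB] mm)) x, f x⟫_ℝ) -
      ν * (Torus.eGradNormSq ((∑ mm, Torus.realTrigPoly {![p, p + q] mm} (fun _ => ![zA, zB] mm)))).toReal) ≤
      2 * Θ * (ν * (4 * Real.pi ^ 2 * (L : ℝ) ^ 2 * (α + α) ^ 2)) := by
    have ha : 2 * θ * (∫ x, ⟪(∑ mm, Torus.realTrigPoly {![p, p + q] mm} (fun _ => ![zA, zB] mm)) x, f x⟫_ℝ) ≤ 0 := by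
      nlinarith
    have hb : -(2 * θ) * (ν * (Torus.eGradNormSq ((∑ mm, Torus.realTrigPoly {![p, p + q] mm} (fun _ => ![zA, zB] mm)))).toReal) ≤
        2 * Θ * (ν * (4 * Real.pi ^ 2 * (L : ℝ) ^ 2 * (α + α) ^ 2)) := by
      calc -(2 * θ) * (ν * (Torus.eGradNormSq ((∑ mm, Torus.realTrigPoly {![p, p + q] mm} (fun _ => ![zA, zB] mm)))).toReal)
          ≤ (2 * Θ) * (ν * (Torus.eGradNormSq ((∑ mm, Torus.realTrigPoly {![p, p + q] mm} (fun _ => ![zA, zB] mm)))).toReal) :=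
            mul_le_mul_of_nonneg_right (by linarith) h5
        _ ≤ 2 * Θ * (ν * (4 * Real.pi ^ 2 * (L : ℝ) ^ 2 * (α + α) ^ 2)) := mul_le_mul_of_nonneg_left h6 (by positivity)
    nlinarith
  -- assemble
  rw [h2, mul_zero, add_zero] at hfloor
  nlinarith [hfloor, h3, h6, h7]

/-! ### The Wiener bound on the injection -/

/-- **Wiener bound.** For smooth `f` and a band-limited continuous `G` whose largest coefficient on the ball
is at `q`: `(f, G) ≤ (Σ_k ‖f̂(k)‖) · ‖Ĝ(q)‖`. -/
theorem integral_inner_le_tsum_mul_max {f G : (UnitAddTorus (Fin 3)) → (EuclideanSpace ℝ (Fin 3))}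
    (hf : Torus.IsSmooth f) (hG : Continuous G) {N : ℕ}
    (hband : ∀ κ, (N : ℝ) ^ 2 < Torus.freqNormSq κ → mFourierCoeff (EuclideanSpace.complexify ∘ G) κ = 0)
    {q : Fin 3 → ℤ}
    (hq : ∀ κ ∈ Torus.freqBall N, ‖(mFourierCoeff (EuclideanSpace.complexify ∘ G) κ)‖ ≤ ‖(mFourierCoeff (EuclideanSpace.complexify ∘ G) q)‖) :
    ∫ x, ⟪f x, G x⟫_ℝ ≤ (∑' κ, ‖mFourierCoeff (EuclideanSpace.complexify ∘ f) κ‖) *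
      ‖(mFourierCoeff (EuclideanSpace.complexify ∘ G) q)‖ := by
  have hGm : MemLp G 2 volume := hG.memLp_of_hasCompactSupport (HasCompactSupport.of_compactSpace G)
  have hsum := Torus.summable_norm_mFourierCoeff_of_isSmooth hf
  rw [Torus.integral_inner_eq_sum_freqBall (hf.memLp 2) hGm hband]
  calc ∑ κ ∈ Torus.freqBall N, (⟪mFourierCoeff (EuclideanSpace.complexify ∘ f) κ,
          mFourierCoeff (EuclideanSpace.complexify ∘ G) κ⟫_ℂ).re
      ≤ ∑ κ ∈ Torus.freqBall N, ‖(mFourierCoeff (EuclideanSpace.complexify ∘ f) κ)‖ * ‖(mFourierCoeff (EuclideanSpace.complexify ∘ G) q)‖ :=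
        Finset.sum_le_sum fun κ hκ => (re_inner_le_norm_mul _ _).trans
          (mul_le_mul_of_nonneg_left (hq κ hκ) (norm_nonneg _))
    _ = (∑ κ ∈ Torus.freqBall N, ‖(mFourierCoeff (EuclideanSpace.complexify ∘ f) κ)‖) * ‖(mFourierCoeff (EuclideanSpace.complexify ∘ G) q)‖ := by
        rw [Finset.sum_mul]
    _ ≤ (∑' κ, ‖mFourierCoeff (EuclideanSpace.complexify ∘ f) κ‖) * ‖(mFourierCoeff (EuclideanSpace.complexify ∘ G) q)‖ :=
        mul_le_mul_of_nonneg_right (hsum.sum_le_tsum _ (fun κ _ => norm_nonneg _)) (norm_nonneg _)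

/-! ### `rpow` bookkeeping -/

/-- From `N ≤ C' ν^{-β}`: `ν N² ≤ C'² ν^{1−2β}`. -/
theorem nu_mul_sq_le {ν C' N β : ℝ} (hν : 0 < ν) (hN0 : 0 ≤ N) (hN : N ≤ C' * ν ^ (-β)) :
    ν * N ^ 2 ≤ C' ^ 2 * ν ^ (1 - 2 * β) := by
  have h1 : N ^ 2 ≤ (C' * ν ^ (-β)) ^ 2 := pow_le_pow_left₀ hN0 hN 2
  have h2 : (ν ^ (-β)) ^ 2 = ν ^ (-β + -β) := by rw [sq, Real.rpow_add hν]
  have h3 : ν ^ (1 - 2 * β) = ν * ν ^ (-β + -β) := by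
    rw [show (1 - 2 * β : ℝ) = 1 + (-β + -β) by ring, Real.rpow_add hν, Real.rpow_one]
  calc ν * N ^ 2 ≤ ν * (C' * ν ^ (-β)) ^ 2 := mul_le_mul_of_nonneg_left h1 hν.le
    _ = C' ^ 2 * (ν * ν ^ (-β + -β)) := by rw [mul_pow, h2]; ring
    _ = C' ^ 2 * ν ^ (1 - 2 * β) := by rw [h3]

/-- If `0 < ν ≤ t^{1/γ}` with `γ, t > 0` then `ν^γ ≤ t`. -/
theorem rpow_le_of_le_root {ν t γ : ℝ} (hν : 0 < ν) (ht : 0 < t) (hγ : 0 < γ) (h : ν ≤ t ^ (1 / γ)) :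
    ν ^ γ ≤ t := by
  calc ν ^ γ ≤ (t ^ (1 / γ)) ^ γ := Real.rpow_le_rpow hν.le h hγ.le
    _ = t := by rw [← Real.rpow_mul ht.le, one_div_mul_cancel hγ.ne', Real.rpow_one]

/-! ### Real endgame -/

/-- **Endgame below Taylor.** `gain + ε₀ ≤ (f,G) + cost` with `(f,G) ≤ A gₙ`, `gain ≥ (9/10)α²gₙ`,
`α² = (10/9)(A+1)`, carriers `≤ 4N+1 ≤ 5N`, `ν N² ≤ C'² X` and `4500(1+2Θ)C'²(A+1)X < ε₀` is absurd. -/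
theorem endgame_below {Θ A gn gain ε₀ ν X N C' α inj : ℝ} (hΘ : 0 ≤ Θ) (hA : 0 ≤ A) (hgn : 0 ≤ gn)
    (hν : 0 < ν) (hC' : 1 ≤ C') (hN1 : 1 ≤ N) (hνN : ν * N ^ 2 ≤ C' ^ 2 * X)
    (hX : 4500 * (1 + 2 * Θ) * C' ^ 2 * (A + 1) * X < ε₀)
    (hα2 : α ^ 2 = 10 / 9 * (A + 1)) (hinj : inj ≤ A * gn) (hgain : 9 / 10 * α ^ 2 * gn ≤ gain)
    (hmain : gain + ε₀ ≤ inj + (1 + 2 * Θ) * (ν * (4 * Real.pi ^ 2 * (4 * N + 1) ^ 2 * (α + α) ^ 2))) : False := by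
  have hX0 : 0 ≤ X := by
    have : 0 ≤ ν * N ^ 2 := by positivity
    have hC2 : 0 < C' ^ 2 := by positivity
    nlinarith
  -- the gain absorbs the injection
  have hgi : inj + gn ≤ gain := by
    have e : 9 / 10 * α ^ 2 * gn = A * gn + gn := by rw [hα2]; ring
    linarith
  -- the cost
  have hpi : Real.pi ^ 2 < 10 := by
    have h' : Real.pi ^ 2 < (3.15 : ℝ) ^ 2 := pow_lt_pow_left₀ Real.pi_lt_d2 Real.pi_pos.le two_ne_zero
    norm_num at h'
    linarith
  have h45 : (4 * N + 1) ^ 2 ≤ 25 * N ^ 2 := by nlinarith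
  have hαα : (α + α) ^ 2 = 40 / 9 * (A + 1) := by rw [show (α + α) ^ 2 = 4 * α ^ 2 by ring, hα2]; ring
  have hcost : (1 + 2 * Θ) * (ν * (4 * Real.pi ^ 2 * (4 * N + 1) ^ 2 * (α + α) ^ 2)) ≤
      4500 * (1 + 2 * Θ) * C' ^ 2 * (A + 1) * X := by
    rw [hαα]
    have h1 : ν * (4 * Real.pi ^ 2 * (4 * N + 1) ^ 2 * (40 / 9 * (A + 1))) ≤
        ν * (4 * Real.pi ^ 2 * (25 * N ^ 2) * (40 / 9 * (A + 1))) := by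
      refine mul_le_mul_of_nonneg_left ?_ hν.le
      gcongr
    have h2 : ν * (4 * Real.pi ^ 2 * (25 * N ^ 2) * (40 / 9 * (A + 1))) =
        (4000 / 9 * Real.pi ^ 2) * (A + 1) * (ν * N ^ 2) := by ring
    have h3 : (4000 / 9 * Real.pi ^ 2) * (A + 1) * (ν * N ^ 2) ≤ (4000 / 9 * Real.pi ^ 2) * (A + 1) * (C' ^ 2 * X) :=
      mul_le_mul_of_nonneg_left hνN (by positivity)
    have h4 : (4000 / 9 * Real.pi ^ 2) * (A + 1) * (C' ^ 2 * X) ≤ 4500 * (A + 1) * (C' ^ 2 * X) := by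
      have : 0 ≤ (A + 1) * (C' ^ 2 * X) := by positivity
      nlinarith
    have hΘ1 : 0 ≤ 1 + 2 * Θ := by linarith
    calc (1 + 2 * Θ) * (ν * (4 * Real.pi ^ 2 * (4 * N + 1) ^ 2 * (40 / 9 * (A + 1))))
        ≤ (1 + 2 * Θ) * (4500 * (A + 1) * (C' ^ 2 * X)) := by
          refine mul_le_mul_of_nonneg_left ?_ hΘ1
          linarith
      _ = 4500 * (1 + 2 * Θ) * C' ^ 2 * (A + 1) * X := by ring
  linarith

end Summit.AnomalousDissipation.AnomalousDissipation.Theorems.KolmogorovFloor.Negative
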